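import Literature.MathematicalPhysics.QuantumFieldTheory.LatticeGaugeDobrushinPoincare
import HarnessLib

/-!
# `Balaban1983to89.StrongCouplingDobrushinWindow` — the one-link Dobrushin–Vasserstein window of `SU(N)` lattice
# Yang–Mills at a GIVEN coupling, kernel level; the `SU(2)` certificate schema J-SC3

**Observatory of the non-perturbative crossover; no mass-gap claim.**

Audit cell `pub-balaban`, build IR-3 v2, seat `b2b-balaban-ir-sc-g2` (strong-coupling front, generation 2).  Value = ONE
KERNEL THEOREM with every hypothesis explicit and ONE NAMED HYPOTHESIS (`Prop`-valued definition) that an off-kernel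
certificate decides; NOTHING about the certificate's truth is asserted here.

THE THEOREM (`dlrMassGap_of_oneLinkKRModulus`, Dobrushin 1970 / Föllmer 1988 route, all lattice-side steps proved in the
tree by `LatticeGaugeDobrushin.lean` and `LatticeGaugeDobrushinPoincare.lean`).  Fix `d ≥ 2`, `N ≥ 2` and a 't Hooft
coupling `β` (bare coupling `N β` of `ymSpecification (fundamentalRep (Fin N)) (N * β)`, weight `exp(N β Σ_p Re tr U_p)`).
The one-link conditional law at `x` is the tilted Haar measure `ν_B(dg) ∝ exp(N Re tr(g B)) dg` with
`B = B_ω = β Σ_{p ∋ x}(staple)` (`siteLaw_ymSpecification_thooft`), `‖B_ω‖_op ≤ 2(d-1)|β|` (`matrixOpNorm_stapleField_le`),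
`‖B_ω − B_η‖_F ≤ |β| n(x,y) ‖ω_y − η_y‖_F` (`frobNorm_stapleField_sub_le`), `Σ_y n(x,y) ≤ 6(d-1)` (`sum_linkInfluence_le`).
HYPOTHESIS `OneLinkKRModulus N R K`: on the operator-norm ball `‖B‖_op ≤ R` the map `B ↦ ν_B` is `K`-Lipschitz from the
Frobenius norm to the Kantorovich–Rubinstein distance dual to the Frobenius distance on `SU(N)` (tested, as everywhere in the
tree's Dobrushin files, on bounded measurable Lipschitz `φ`).  CONCLUSION, whenever `2(d-1)|β| ≤ R` and the Dobrushin
constant `c = 6(d-1)|β| K < 1`: the DLR state is unique and covariances of Lipschitz cylinder functions decay as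
`c₁ e^{-m · dist(Λ₁, Λ₂)}` with the EXPLICIT rate `m = -log max(c, 1/2)` (lattice units of `setDistEdges`) — literally the
body of the registered fact `shen_zhu_zhu d N` (Shen–Zhu–Zhu CMP 400 (2023), Thm. 1.2 + Cor. 1.6 "Mass gap") at this one `β`,
i.e. the crossover ledger's currency SC-a (`ir/UNITS.md`, `ir/FRONT-SC.md` §U).  Shen–Zhu–Zhu's own input is the special
case `K = 1/(1/2 − R)` (`R < 1/2`) delivered by the one-link Bakry–Émery bound (`shen_zhu_zhu_of_haarPoincare`), whence their
window `|β| < 1/(16(d-1))`, i.e. `β_W < 1/12` for `SU(2)`, `d = 4`.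

THE `SU(2)` SCHEMA (J-SC3).  Wilson units `β_W = 4/g² = N² β = 4β` (`ir/UNITS.md`; tree bare coupling `β_t = β_W/2`).
`OneLinkKRModulusSU2 βW K₂ := OneLinkKRModulus 2 (3 βW / 2) (4 K₂)` and
`su2_dlrMassGap_of_oneLinkKRModulus : 0 ≤ βW → 0 ≤ K₂ → OneLinkKRModulusSU2 βW K₂ → 18 βW K₂ < 1 → DLRMassGapAt 4 2 (βW/4) (rate)`.
The companion certificate (`run/shared/lean/pub/pub-balaban/ir/FRONT-SC.md` §3b, data `ir/data/FRONT-SC-JSC3-certificate.json`)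
supplies, OFF KERNEL and labelled as such: (A) a pen-and-paper transport lemma — for `SU(2) ≅ S³` the law `ν_B` is the
von Mises–Fisher law `∝ e^{⟨q, m_B⟩}` with `|m_B| ≤ 4‖B‖_op`, `|m_B − m_B'| ≤ 2√2 ‖B − B'‖_F`, and an explicit pair of
divergence-form vector fields on `S³` (meridional `ρ y(t) ∇t`, transverse `ρ w(κ t) ∇s`) bounds the Kantorovich–Rubinstein
derivative by `K₂(κ) = max(P, W)(κ)`, two explicit one-dimensional integrals with `K₂(0) = 1/√12` (against Bakry–Émery's
`1/2`); hence `OneLinkKRModulusSU2 βW K₂*` with `K₂* = sup_{κ ≤ 6 βW} K₂(κ)`; (C) two interval-arithmetic engines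
(python-flint/Arb and mpmath-iv) bounding `K₂` on boxes covering `[0, 6 βW]`.  Neither (A) nor (C) is a tree theorem; the
schema below takes the modulus as a HYPOTHESIS.  No constant of any paper under audit is used anywhere.

CITATION HEADER (lean-in-tree rule).  (SZZ23) H. Shen, R. Zhu, X. Zhu, *A stochastic analysis approach to lattice
Yang–Mills at strong coupling*, CMP **400** (2023) 805–851, arXiv:2204.12737 — held (`paper:arxiv-2204.12737`; item numbers
and pages below = the printed arXiv v1 PDF; the held TeX layer drops theorem heads, shows the LaTeX label `th:1.3` for Thm. 1.2, and its
chunk files `p000N` are not pages): Assumption 1.1 (arXiv text p. 4) "`K_𝒮 > 0`" ⟺ `|β| < 1/(16(d−1))` for `SU(N)`, Thm. 1.2 [Uniqueness and ergodicity] (p. 5), Rem. 1.3, the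
UNNUMBERED REMARK after it (p. 6; held-text chunk `p0005 L35`): «uniqueness for small β could possibly also be proven using the method
of Dobrushin … one would also need to consider the related Wasserstein metric with respect to the Riemannian distance … such an
argument has not been carried out in detail for lattice Yang Mills in the literature» — THIS MODULE IS THAT ARGUMENT, kernel-checked
on the lattice side, with the one-link input isolated as a named hypothesis —, Lemma 4.1 (Hessian bound, p. 17) with the Ricci identity (4.8) (p. 19; after [AGZ10, (F.6)]),
Cor. 1.6 [Mass gap] (p. 7; held-text chunk `p0006 L37–45`; printed with the factor `d_𝔤 = dim_ℝ 𝔤`, absorbed in `c₁` here).  (Föl88) H. Föllmer, *Random fields and diffusion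
processes*, École d'Été de Saint-Flour XV–XVII, LNM **1362** (1988), Ch. I (2.7)–(2.24) (Dobrushin's contraction technique,
Vasserstein form) — the mechanism of `LatticeGaugeDobrushin.lean`, cited there.  (Dob70) R. L. Dobrushin, *Prescribing a
system of random variables by conditional distributions*, Theory Probab. Appl. **15** (1970) 458–486, Thm. 4.

WHAT THIS MODULE DOES.
* `OneLinkKRModulus N R K` — the named one-link hypothesis (a `Prop`; for `SU(2)` decided off-kernel by J-SC3, never asserted).
* `DLRClusteringAt d N β m`, `DLRMassGapAt d N β` — the SC-a currency at ONE coupling (the body of `shen_zhu_zhu` at `β`,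
  with resp. without the rate named).
* `dlrMassGap_of_oneLinkKRModulus` — KERNEL THEOREM: modulus on the ball of radius `R ≥ 2(d-1)|β|` and `6(d-1)|β|K < 1` ⇒
  uniqueness ∧ `DLRClusteringAt d N β (−log max(6(d-1)|β|K, 1/2))`.
* `OneLinkKRModulusSU2`, `su2_dlrMassGap_of_oneLinkKRModulus`, `su2_dlrMassGapAt_of_le` — the `SU(2)`, `d = 4` bookkeeping in
  Wilson units.
* §4 CONSISTENCY WITH S16: `oneLinkKRModulus_of_haarPoincare` — the one-link Poincaré inequality in Lipschitz form (the
  hypothesis `hLP` of `shen_zhu_zhu_of_haarPoincare`, = Bakry–Émery `CD(N(1/2 − ‖B‖_op), ∞)`) gives `OneLinkKRModulus N R (1/(1/2 − R))`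
  for `R < 1/2`; `dlrMassGapAt_of_haarPoincare` — fed into the kernel theorem this returns EXACTLY Shen–Zhu–Zhu's window
  `|β| < 1/(16(d−1))` (`6(d−1)|β|/(1/2 − 2(d−1)|β|) < 1`), i.e. the kernel theorem is the tree's S16 pipeline with the one-link constant
  exposed as a parameter — the parameter the certificate improves for `SU(2)` (`1/(1/2 − R)` ≥ 2 against `4 K₂* ≈ 1.16`).
-/

open MeasureTheory Filter Topology ProbabilityTheory Function
open scoped NNReal
open Literature.Probability.LatticeModels
open Literature.Probability.LatticeModels.DobrushinMetric
open Literature.MathematicalPhysics.QuantumLattice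

namespace Literature.MathematicalPhysics.QuantumFieldTheory.Balaban1983to89.StrongCouplingDobrushinWindow

open Literature.MathematicalPhysics.QuantumFieldTheory

variable {d N : ℕ}

/-! ## §1 The named one-link hypothesis and the SC-a currency at one coupling -/

/-- **One-link Kantorovich–Rubinstein modulus** of the tilted Haar family `ν_B(dg) ∝ exp(N Re tr(g B)) dg` on `SU(N)`:
on the operator-norm ball `‖B‖_op ≤ R`, for every bounded measurable `φ` that is `L`-Lipschitz for the Frobenius distance,
`|∫ φ dν_B − ∫ φ dν_{B'}| ≤ K · L · ‖B − B'‖_F`.  A HYPOTHESIS SCHEMA (for `SU(2)` it is what certificate J-SC3 decides off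
kernel); Shen–Zhu–Zhu's Bakry–Émery computation gives it with `K = 1/(1/2 − R)` for `R < 1/2`
(`oneLinkKRModulus_of_haarPoincare` below, from the one-link Poincaré inequality in Lipschitz form).
[cite: arXiv220412737, Lemma 4.1 and the unnumbered remark p. 6 (after Rem. 1.3; Dobrushin route)] -/
def OneLinkKRModulus (N : ℕ) (R K : ℝ) : Prop :=
  ∀ B B' : Matrix (Fin N) (Fin N) ℂ, matrixOpNorm B ≤ R → matrixOpNorm B' ≤ R →
    ∀ (φ : Matrix.specialUnitaryGroup (Fin N) ℂ → ℝ) (L : ℝ), Measurable φ → (∃ M, ∀ s, |φ s| ≤ M) → 0 ≤ L →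
      (∀ a b, |φ a - φ b| ≤ L * suFrobDist a b) →
      |∫ s, φ s ∂((haarProbability (Matrix.specialUnitaryGroup (Fin N) ℂ)).tilted
            fun g => (N : ℝ) * ((g : Matrix (Fin N) (Fin N) ℂ) * B).trace.re) -
          ∫ s, φ s ∂((haarProbability (Matrix.specialUnitaryGroup (Fin N) ℂ)).tilted
            fun g => (N : ℝ) * ((g : Matrix (Fin N) (Fin N) ℂ) * B').trace.re)| ≤
        K * L * frobNorm (B - B')

/-- The modulus hypothesis is monotone in the radius: a modulus on a larger ball is one on a smaller ball. [folklore] -/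
theorem OneLinkKRModulus.mono_radius {R R' K : ℝ} (h : OneLinkKRModulus N R K) (hle : R' ≤ R) :
    OneLinkKRModulus N R' K :=
  fun B B' hB hB' => h B B' (hB.trans hle) (hB'.trans hle)

variable (d N) in
/-- **Exponential clustering of the DLR states at 't Hooft coupling `β` with rate `m`** (SC-a currency at one coupling):
for every DLR state of `ymSpecification (fundamentalRep (Fin N)) (N β)` and every support bound `n` ONE constant `c₁` with
`|cov(F₁, F₂)| ≤ c₁ e^{−m d(Λ₁, Λ₂)} (K₁ K₂ + ‖F₁‖₂ ‖F₂‖₂)` for Lipschitz cylinder functions — the covariance clause of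
`shen_zhu_zhu d N` at this `β` with the rate exposed.  Statement-level predicate, no claim.
[cite: arXiv220412737, Cor. 1.6 (Mass gap)] -/
def DLRClusteringAt (β m : ℝ) : Prop :=
  ∀ μ ∈ ymGibbsMeasures (d := d) (fundamentalRep (Fin N)) (N * β),
    ∀ n : ℕ, ∃ c₁ : ℝ,
      ∀ (F₁ F₂ : LGConfig d (Matrix.specialUnitaryGroup (Fin N) ℂ) → ℝ)
        (Λ₁ Λ₂ : Finset (ZdEdge d)) (K₁ K₂ : ℝ≥0),
        Λ₁.card ≤ n → Λ₂.card ≤ n → Disjoint Λ₁ Λ₂ →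
        IsLipschitzCylinder (fundamentalRep (Fin N)) F₁ Λ₁ K₁ →
        IsLipschitzCylinder (fundamentalRep (Fin N)) F₂ Λ₂ K₂ →
          |cov[F₁, F₂; μ]| ≤ c₁ * Real.exp (-m * setDistEdges Λ₁ Λ₂) *
            ((K₁ : ℝ) * K₂ + Real.sqrt (∫ U, F₁ U ^ 2 ∂μ) * Real.sqrt (∫ U, F₂ U ^ 2 ∂μ))

variable (d N) in
/-- **DLR uniqueness and mass gap at 't Hooft coupling `β`** (SC-a): `|𝒢| = 1` and exponential clustering at some rate
`m > 0` — the body of the registered fact `shen_zhu_zhu d N` at ONE coupling, outside or inside Shen–Zhu–Zhu's window.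
Statement-level predicate, no claim. [cite: arXiv220412737, Thm. 1.2 and Cor. 1.6 (Mass gap)] -/
def DLRMassGapAt (β : ℝ) : Prop :=
  HasUniqueGibbsMeasure (ymSpecification (d := d) (fundamentalRep (Fin N)) (N * β)) ∧
    ∃ m : ℝ, 0 < m ∧ DLRClusteringAt d N β m

/-- Inside Shen–Zhu–Zhu's window the registered fact gives `DLRMassGapAt` (consistency of the currency with S16).
[cite: arXiv220412737, Thm. 1.2 and Cor. 1.6 (Mass gap)] -/
theorem dlrMassGapAt_of_shen_zhu_zhu (h : shen_zhu_zhu d N) (hd : 2 ≤ d) (hN : 2 ≤ N) {β : ℝ}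
    (hβ : |β| < 1 / (16 * ((d : ℝ) - 1))) :
    HasUniqueGibbsMeasure (ymSpecification (d := d) (fundamentalRep (Fin N)) (N * β)) ∧
      ∀ μ ∈ ymGibbsMeasures (d := d) (fundamentalRep (Fin N)) (N * β), ∃ m : ℝ, 0 < m ∧
        ∀ n : ℕ, ∃ c₁ : ℝ,
          ∀ (F₁ F₂ : LGConfig d (Matrix.specialUnitaryGroup (Fin N) ℂ) → ℝ)
            (Λ₁ Λ₂ : Finset (ZdEdge d)) (K₁ K₂ : ℝ≥0),
            Λ₁.card ≤ n → Λ₂.card ≤ n → Disjoint Λ₁ Λ₂ →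
            IsLipschitzCylinder (fundamentalRep (Fin N)) F₁ Λ₁ K₁ →
            IsLipschitzCylinder (fundamentalRep (Fin N)) F₂ Λ₂ K₂ →
              |cov[F₁, F₂; μ]| ≤ c₁ * Real.exp (-m * setDistEdges Λ₁ Λ₂) *
                ((K₁ : ℝ) * K₂ + Real.sqrt (∫ U, F₁ U ^ 2 ∂μ) * Real.sqrt (∫ U, F₂ U ^ 2 ∂μ)) :=
  h hd hN β hβ

/-! ## §2 The kernel theorem: Dobrushin's uniqueness and clustering from the one-link modulus at a given coupling -/

/-- **Dobrushin–Vasserstein mass gap from a one-link Kantorovich–Rubinstein modulus, at a given coupling.**  Let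
`d ≥ 2`, `N ≥ 2`, `β` a 't Hooft coupling, `R ≥ 2(d-1)|β|`, and suppose `OneLinkKRModulus N R K` with `K ≥ 0` and
Dobrushin constant `c := 6(d-1)|β|K < 1`.  Then the `SU(N)` lattice Yang–Mills DLR state at bare coupling `N β` is unique
and `DLRClusteringAt d N β m` holds with `m = −log max(c, 1/2)`; the constant is `c₁ = 2 R₀² n² e^{m}`, `R₀ = 2√N`.
Proof = the Dobrushin route of `shen_zhu_zhu_of_dobrushinCondition` run at this one `β`: the one-link laws are `ν_{B_ω}`
(`siteLaw_ymSpecification_thooft`), `‖B_ω‖_op ≤ 2(d-1)|β| ≤ R`, the modulus and `frobNorm_stapleField_sub_le` give the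
influence coefficients `C(x,y) = K|β| n(x,y)` for the Frobenius weight (`R₀ = 2√N`, `A = 1`), `sum_linkInfluence_le` gives
the row sums `≤ 6(d-1)|β|K = c`; uniqueness by `subsingleton_gibbsMeasures_of_isKRContraction` + `shen_zhu_zhu_nonempty`,
clustering by `abs_covariance_le_of_isKRContraction` with the profile `⌊linkSetDist Λ₂⌋`.
[cite: Follmer1988, Ch. I (2.7)–(2.24)] [cite: arXiv220412737, unnumbered remark p. 6 (after Rem. 1.3; Dobrushin route) with Thm. 1.2 (Uniqueness and ergodicity) and Cor. 1.6 (Mass gap)] -/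
theorem dlrMassGap_of_oneLinkKRModulus (hd : 2 ≤ d) (hN : 2 ≤ N) {β R K : ℝ} (hK : 0 ≤ K)
    (hR : |β| * (2 * ((d : ℝ) - 1)) ≤ R) (hmod : OneLinkKRModulus N R K)
    (hsmall : 6 * ((d : ℝ) - 1) * |β| * K < 1) :
    HasUniqueGibbsMeasure (ymSpecification (d := d) (fundamentalRep (Fin N)) (N * β)) ∧
      DLRClusteringAt d N β (-Real.log (max (6 * ((d : ℝ) - 1) * |β| * K) (1 / 2))) := by
  classical
  -- `SU(N) ⊆ M_N(ℂ)` is second countable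
  haveI : SecondCountableTopology (Matrix (Fin N) (Fin N) ℂ) :=
    inferInstanceAs (SecondCountableTopology (Fin N → Fin N → ℂ))
  haveI : SecondCountableTopology (Matrix.specialUnitaryGroup (Fin N) ℂ) :=
    Topology.IsEmbedding.subtypeVal.secondCountableTopology
  -- constants
  have hd2 : (2 : ℝ) ≤ d := by exact_mod_cast hd
  have hd0 : (0 : ℝ) < (d : ℝ) - 1 := by linarith
  have hN0 : (0 : ℝ) < N := by exact_mod_cast (show 0 < N by omega)
  have hd1' : 1 ≤ d := by omega
  have hN1 : 1 ≤ N := by omega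
  set c : ℝ := 6 * ((d : ℝ) - 1) * |β| * K with hc
  have hc0 : 0 ≤ c := by positivity
  set C : ZdEdge d → ZdEdge d → ℝ := fun x y => K * |β| * linkInfluence x y with hCdef
  have hC0 : ∀ x y, 0 ≤ C x y := fun x y => by positivity
  -- row sums of the influence coefficients
  have hrow : ∀ x, ∑ y ∈ linkPlaqNbr x, C x y ≤ c := by
    intro x
    simp only [hCdef]
    rw [← Finset.mul_sum]
    have hsum : ∑ y ∈ linkPlaqNbr x, (linkInfluence x y : ℝ) ≤ 6 * ((d : ℝ) - 1) := by
      have h := sum_linkInfluence_le (d := d) x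
      calc ∑ y ∈ linkPlaqNbr x, (linkInfluence x y : ℝ)
          = ((∑ y ∈ linkPlaqNbr x, linkInfluence x y : ℕ) : ℝ) := by push_cast; rfl
        _ ≤ ((6 * (d - 1) : ℕ) : ℝ) := by exact_mod_cast h
        _ = 6 * ((d : ℝ) - 1) := by push_cast [Nat.cast_sub hd1']; ring
    calc K * |β| * ∑ y ∈ linkPlaqNbr x, (linkInfluence x y : ℝ) ≤ K * |β| * (6 * ((d : ℝ) - 1)) :=
          mul_le_mul_of_nonneg_left hsum (by positivity)
      _ = c := by rw [hc]; ring
  -- the one-link Kantorovich–Rubinstein contraction from the modulus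
  have hcontr : ∀ (x : ZdEdge d), ∀ y ∈ linkPlaqNbr x,
      ∀ (ω η : LGConfig d (Matrix.specialUnitaryGroup (Fin N) ℂ)),
      (∀ z, z ≠ y → ω z = η z) →
      ∀ (φ : Matrix.specialUnitaryGroup (Fin N) ℂ → ℝ) (L : ℝ), Measurable φ →
        (∃ M, ∀ s, |φ s| ≤ M) → 0 ≤ L → (∀ a b, |φ a - φ b| ≤ L * suFrobDist a b) →
        |∫ s, φ s ∂(siteLaw (ymSpecification (fundamentalRep (Fin N)) (N * β)) x ω) -
            ∫ s, φ s ∂(siteLaw (ymSpecification (fundamentalRep (Fin N)) (N * β)) x η)| ≤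
          C x y * L * suFrobDist (ω y) (η y) := by
    intro x y _ ω η hωη φ L hφm hφb hL hφL
    rw [siteLaw_ymSpecification_thooft β x ω, siteLaw_ymSpecification_thooft β x η]
    have hBω : matrixOpNorm (stapleField β x ω) ≤ R := (matrixOpNorm_stapleField_le hd1' hN1 β x ω).trans hR
    have hBη : matrixOpNorm (stapleField β x η) ≤ R := (matrixOpNorm_stapleField_le hd1' hN1 β x η).trans hR
    have key := hmod _ _ hBω hBη φ L hφm hφb hL hφL
    refine key.trans ?_
    have hdiff := frobNorm_stapleField_sub_le β x y hωη
    calc K * L * frobNorm (stapleField β x ω - stapleField β x η)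
        ≤ K * L * (|β| * linkInfluence x y * suFrobDist (ω y) (η y)) :=
          mul_le_mul_of_nonneg_left hdiff (mul_nonneg hK hL)
      _ = C x y * L * suFrobDist (ω y) (η y) := by simp only [hCdef]; ring
  have hγ : IsSpecification (ymSpecification (d := d) (fundamentalRep (Fin N)) (N * β)) :=
    isSpecification_ymSpecification_of_t2Space _ (continuous_fundamentalRep (Fin N)) _
  have hKR : IsKRContraction (ymSpecification (d := d) (fundamentalRep (Fin N)) (N * β)) suFrobDist
      linkPlaqNbr C :=
    isKRContraction_ymSpecification _ (continuous_fundamentalRep (Fin N)) _ hC0 hcontr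
  have hR₀ : (0 : ℝ) ≤ 2 * Real.sqrt N := by positivity
  have hA : ∀ a b : Matrix.specialUnitaryGroup (Fin N) ℂ, dist (suEntries a) (suEntries b) ≤ 1 * suFrobDist a b :=
    fun a b => by rw [one_mul]; exact dist_suEntries_le_suFrobDist a b
  refine ⟨?_, ?_⟩
  · -- (i) uniqueness (Dobrushin) and existence (compactness)
    refine (shen_zhu_zhu_hasUniqueGibbsMeasure_iff β).2 ?_
    exact subsingleton_gibbsMeasures_of_isKRContraction hγ hKR suFrobDist_nonneg suFrobDist_le suEntries
      measurableSpace_specialUnitaryGroup_eq_comap zero_le_one hA hc0 hsmall hrow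
  · -- (ii) exponential decay of covariances at the explicit rate
    intro μ hμ n
    set c' : ℝ := max c (1 / 2) with hc'
    have hc'0 : 0 < c' := lt_max_of_lt_right (by norm_num)
    have hc'1 : c' < 1 := max_lt hsmall (by norm_num)
    have hrow' : ∀ x, ∑ y ∈ linkPlaqNbr x, C x y ≤ c' := fun x => (hrow x).trans (le_max_left _ _)
    set κ : ℝ := -Real.log c' with hκ
    have hκ0 : 0 < κ := neg_pos.2 (Real.log_neg hc'0 hc'1)
    refine ⟨2 * (2 * Real.sqrt N) ^ 2 * (1 : ℝ) ^ 2 * (n : ℝ) ^ 2 * Real.exp κ, ?_⟩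
    intro F₁ F₂ Λ₁ Λ₂ K₁ K₂ h₁ h₂ _ hF₁ hF₂
    have hμ' : IsGibbsMeasure (ymSpecification (d := d) (fundamentalRep (Fin N)) (N * β)) μ := hμ
    haveI := hμ'.isProbabilityMeasure
    -- the profile `ℓ = ⌊dist(·, Λ₂)⌋`
    set ℓ : ZdEdge d → ℕ := fun y => ⌊linkSetDist Λ₂ y⌋₊ with hℓ
    have hℓ0 : ∀ y ∈ Λ₂, ℓ y = 0 := fun y hy => by
      simp [hℓ, linkSetDist_eq_zero_of_mem hy]
    have hℓ1 : ∀ x ∉ Λ₂, ∀ y ∈ linkPlaqNbr x, ℓ x ≤ ℓ y + 1 := fun x _ y hy => by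
      calc ℓ x ≤ ⌊linkSetDist Λ₂ y + 1⌋₊ := Nat.floor_mono (linkSetDist_le_add_one hy)
        _ = ℓ y + 1 := Nat.floor_add_one (linkSetDist_nonneg _ _)
    -- the covariance estimate of the Dobrushin regime
    have key := abs_covariance_le_of_isKRContraction hγ hKR suFrobDist_nonneg suFrobDist_le hR₀ hc'0.le
      hc'1.le hrow' hμ'
      hF₁.measurable hF₁.dependsOn hF₁.abs_le (hF₁.isLipBound zero_le_one hA)
      hF₂.measurable hF₂.dependsOn hF₂.abs_le (hF₂.isLipBound zero_le_one hA) ℓ hℓ0 hℓ1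
    have hK₁ : (0 : ℝ) ≤ K₁ := K₁.2
    have hK₂ : (0 : ℝ) ≤ K₂ := K₂.2
    have hn₁ : (Λ₁.card : ℝ) ≤ n := by exact_mod_cast h₁
    have hn₂ : (Λ₂.card : ℝ) ≤ n := by exact_mod_cast h₂
    -- the two sums
    have hsum₂ : ∑ y ∈ Λ₂, (if y ∈ Λ₂ then (1 : ℝ) * (K₂ : ℝ) else 0) ≤ n * (1 * K₂) := by
      rw [Finset.sum_ite_of_true (fun y hy => hy), Finset.sum_const, nsmul_eq_mul]
      exact mul_le_mul_of_nonneg_right hn₂ (by positivity)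
    have hm : ∀ y ∈ Λ₁, ⌊setDistEdges Λ₁ Λ₂⌋₊ ≤ ℓ y := fun y hy =>
      Nat.floor_mono (setDistEdges_le_linkSetDist hy)
    have hsum₁ : ∑ y ∈ Λ₁, c' ^ ℓ y * (if y ∈ Λ₁ then (1 : ℝ) * (K₁ : ℝ) else 0) ≤
        n * (c' ^ ⌊setDistEdges Λ₁ Λ₂⌋₊ * (1 * K₁)) := by
      calc ∑ y ∈ Λ₁, c' ^ ℓ y * (if y ∈ Λ₁ then (1 : ℝ) * (K₁ : ℝ) else 0)
          ≤ ∑ y ∈ Λ₁, c' ^ ⌊setDistEdges Λ₁ Λ₂⌋₊ * (1 * K₁) := Finset.sum_le_sum fun y hy => by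
            rw [if_pos hy]
            exact mul_le_mul_of_nonneg_right (pow_le_pow_of_le_one hc'0.le hc'1.le (hm y hy))
              (by positivity)
        _ = Λ₁.card * (c' ^ ⌊setDistEdges Λ₁ Λ₂⌋₊ * (1 * K₁)) := by
            rw [Finset.sum_const, nsmul_eq_mul]
        _ ≤ n * (c' ^ ⌊setDistEdges Λ₁ Λ₂⌋₊ * (1 * K₁)) :=
            mul_le_mul_of_nonneg_right hn₁ (by positivity)
    -- the geometric factor `c'^{⌊d⌋} ≤ e^{κ} e^{-κ d}`
    have hgeom : c' ^ ⌊setDistEdges Λ₁ Λ₂⌋₊ ≤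
        Real.exp κ * Real.exp (-κ * setDistEdges Λ₁ Λ₂) := by
      have hfl : setDistEdges Λ₁ Λ₂ - 1 ≤ (⌊setDistEdges Λ₁ Λ₂⌋₊ : ℝ) := by
        have := Nat.lt_floor_add_one (setDistEdges Λ₁ Λ₂)
        linarith
      rw [← Real.exp_add, ← Real.rpow_natCast, Real.rpow_def_of_pos hc'0]
      refine Real.exp_le_exp.2 ?_
      have hlog : Real.log c' = -κ := by rw [hκ, neg_neg]
      rw [hlog]
      have := mul_le_mul_of_nonneg_left hfl hκ0.le
      linarith
    have hsD := setDistEdges_nonneg Λ₁ Λ₂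
    calc |cov[F₁, F₂; μ]|
        ≤ 2 * (2 * Real.sqrt N) ^ 2 * (∑ y ∈ Λ₂, (if y ∈ Λ₂ then (1 : ℝ) * (K₂ : ℝ) else 0)) *
            ∑ y ∈ Λ₁, c' ^ ℓ y * (if y ∈ Λ₁ then (1 : ℝ) * (K₁ : ℝ) else 0) := key
      _ ≤ 2 * (2 * Real.sqrt N) ^ 2 * (n * (1 * K₂)) * (n * (c' ^ ⌊setDistEdges Λ₁ Λ₂⌋₊ * (1 * K₁))) := by
          refine mul_le_mul (mul_le_mul_of_nonneg_left hsum₂ (by positivity)) hsum₁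
            (Finset.sum_nonneg fun y hy => ?_) (by positivity)
          rw [if_pos hy]; positivity
      _ ≤ 2 * (2 * Real.sqrt N) ^ 2 * (n * (1 * K₂)) *
            (n * (Real.exp κ * Real.exp (-κ * setDistEdges Λ₁ Λ₂) * (1 * K₁))) := by
          gcongr
      _ = 2 * (2 * Real.sqrt N) ^ 2 * (1 : ℝ) ^ 2 * (n : ℝ) ^ 2 * Real.exp κ *
            Real.exp (-κ * setDistEdges Λ₁ Λ₂) * ((K₁ : ℝ) * K₂) := by ring
      _ ≤ 2 * (2 * Real.sqrt N) ^ 2 * (1 : ℝ) ^ 2 * (n : ℝ) ^ 2 * Real.exp κ *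
            Real.exp (-κ * setDistEdges Λ₁ Λ₂) *
            ((K₁ : ℝ) * K₂ + Real.sqrt (∫ U, F₁ U ^ 2 ∂μ) * Real.sqrt (∫ U, F₂ U ^ 2 ∂μ)) := by
          gcongr
          exact le_add_of_nonneg_right (by positivity)

/-- Corollary in the rate-free currency `DLRMassGapAt`. [folklore] -/
theorem dlrMassGapAt_of_oneLinkKRModulus (hd : 2 ≤ d) (hN : 2 ≤ N) {β R K : ℝ} (hK : 0 ≤ K)
    (hR : |β| * (2 * ((d : ℝ) - 1)) ≤ R) (hmod : OneLinkKRModulus N R K)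
    (hsmall : 6 * ((d : ℝ) - 1) * |β| * K < 1) : DLRMassGapAt d N β := by
  obtain ⟨h1, h2⟩ := dlrMassGap_of_oneLinkKRModulus hd hN hK hR hmod hsmall
  refine ⟨h1, _, ?_, h2⟩
  have hc1 : max (6 * ((d : ℝ) - 1) * |β| * K) (1 / 2) < 1 := max_lt hsmall (by norm_num)
  have hc0 : 0 < max (6 * ((d : ℝ) - 1) * |β| * K) (1 / 2) := lt_max_of_lt_right (by norm_num)
  exact neg_pos.2 (Real.log_neg hc0 hc1)

/-! ## §3 `SU(2)`, `d = 4`, Wilson units: the certificate schema J-SC3 -/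

/-- **The `SU(2)` one-link modulus in Wilson units**: `OneLinkKRModulus 2 (3 βW/2) (4 K₂)` — radius `3βW/2 = 6 · (βW/4)`
is the operator-norm bound of the link field at 't Hooft coupling `βW/4` in `d = 4` (`matrixOpNorm_stapleField_le`), and
`4 K₂` converts a Kantorovich–Rubinstein rate `K₂` per unit EUCLIDEAN shift of the von Mises–Fisher parameter `m_B ∈ ℝ⁴`
(`|m_B − m_B'| ≤ 2√2 ‖B − B'‖_F`, test functions `√2 L`-Lipschitz for the round metric of `S³`) into the Frobenius
units of `OneLinkKRModulus`.  HYPOTHESIS SCHEMA decided off kernel by certificate J-SC3 (transport lemma + interval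
arithmetic, `ir/FRONT-SC.md` §3b); never asserted. [cite: arXiv220412737, Lemma 4.1 and the unnumbered remark p. 6 (after Rem. 1.3; Dobrushin route)] -/
def OneLinkKRModulusSU2 (βW K₂ : ℝ) : Prop :=
  OneLinkKRModulus 2 (3 * βW / 2) (4 * K₂)

/-- **J-SC3 window, kernel part.**  For `SU(2)` on `ℤ⁴` at Wilson coupling `βW ≥ 0` ('t Hooft coupling `βW/4`, tree bare
coupling `2 · (βW/4) = βW/2`): the one-link modulus `OneLinkKRModulusSU2 βW K₂` with `18 βW K₂ < 1` gives DLR uniqueness and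
exponential clustering at the explicit rate `−log max(18 βW K₂, 1/2)`.  (`6(d-1)|β|K = 18 (βW/4)(4K₂) = 18 βW K₂`.)
With the certificate's `K₂* ≈ 0.289 ≥ 1/√12` this is the window `βW ≲ 0.19`, against `1/12` from `K = 1/(1/2 − R)`.
Every hypothesis explicit; nothing about the certificate asserted. [cite: arXiv220412737, unnumbered remark p. 6 (after Rem. 1.3; Dobrushin route) with Thm. 1.2 (Uniqueness and ergodicity) and Cor. 1.6 (Mass gap)] -/
theorem su2_dlrMassGap_of_oneLinkKRModulus {βW K₂ : ℝ} (hβ : 0 ≤ βW) (hK : 0 ≤ K₂)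
    (hmod : OneLinkKRModulusSU2 βW K₂) (hsmall : 18 * βW * K₂ < 1) :
    HasUniqueGibbsMeasure (ymSpecification (d := 4) (fundamentalRep (Fin 2)) (2 * (βW / 4))) ∧
      DLRClusteringAt 4 2 (βW / 4) (-Real.log (max (18 * βW * K₂) (1 / 2))) := by
  have hR : |βW / 4| * (2 * (((4 : ℕ) : ℝ) - 1)) ≤ 3 * βW / 2 := by
    rw [abs_of_nonneg (by positivity)]; push_cast; linarith
  have hs : 6 * (((4 : ℕ) : ℝ) - 1) * |βW / 4| * (4 * K₂) < 1 := by
    rw [abs_of_nonneg (by positivity)]; push_cast; linarith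
  have h := dlrMassGap_of_oneLinkKRModulus (d := 4) (N := 2) (by norm_num) (by norm_num) (by positivity) hR hmod hs
  have he : 6 * (((4 : ℕ) : ℝ) - 1) * |βW / 4| * (4 * K₂) = 18 * βW * K₂ := by
    rw [abs_of_nonneg (by positivity)]; push_cast; ring
  rw [he] at h
  exact h

/-- The rate-free form: `DLRMassGapAt 4 2 (βW/4)`. [folklore] -/
theorem su2_dlrMassGapAt_of_oneLinkKRModulus {βW K₂ : ℝ} (hβ : 0 ≤ βW) (hK : 0 ≤ K₂)
    (hmod : OneLinkKRModulusSU2 βW K₂) (hsmall : 18 * βW * K₂ < 1) : DLRMassGapAt 4 2 (βW / 4) := by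
  have hR : |βW / 4| * (2 * (((4 : ℕ) : ℝ) - 1)) ≤ 3 * βW / 2 := by
    rw [abs_of_nonneg (by positivity)]; push_cast; linarith
  have hs : 6 * (((4 : ℕ) : ℝ) - 1) * |βW / 4| * (4 * K₂) < 1 := by
    rw [abs_of_nonneg (by positivity)]; push_cast; linarith
  exact dlrMassGapAt_of_oneLinkKRModulus (d := 4) (N := 2) (by norm_num) (by norm_num) (by positivity) hR hmod hs

/-- The window propagates downward in `βW` at fixed `K₂` (smaller coupling, smaller radius, same modulus constant):
bookkeeping for the ledger's "front at `β₀`" reading. [folklore] -/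
theorem su2_dlrMassGapAt_of_le {β₀W βW K₂ : ℝ} (h0 : 0 ≤ βW) (hle : βW ≤ β₀W) (hK : 0 ≤ K₂)
    (hmod : OneLinkKRModulusSU2 β₀W K₂) (hsmall : 18 * β₀W * K₂ < 1) : DLRMassGapAt 4 2 (βW / 4) := by
  refine su2_dlrMassGapAt_of_oneLinkKRModulus h0 hK (OneLinkKRModulus.mono_radius hmod (by linarith)) ?_
  calc 18 * βW * K₂ ≤ 18 * β₀W * K₂ := by gcongr
    _ < 1 := hsmall

/-! ## §4 Consistency with S16: the Bakry–Émery modulus `K = 1/(1/2 − R)` and Shen–Zhu–Zhu's window recovered -/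

/-- **The one-link Poincaré inequality gives the modulus `1/(1/2 − R)`.**  If for every `B` with `‖B‖_op < 1/2` the tilted Haar
law `ν_B` satisfies `Var_{ν_B}(ψ) ≤ M²/(N(1/2 − ‖B‖_op))` for `M`-Lipschitz `ψ` (Frobenius distance) — hypothesis `hLP`, the
Bakry–Émery bound of Shen–Zhu–Zhu Lemma 4.1 / (4.7)–(4.8) in the one-link case, exactly as in `shen_zhu_zhu_of_haarPoincare` — then
`OneLinkKRModulus N R (1/(1/2 − R))` for every `R < 1/2`: the perturbation lemma `abs_integral_tilted_add_sub_le` along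
`ν_{(1−t)B + tB'}` with `w(g) = N Re tr(g(B' − B))`, which is `N‖B − B'‖_F`-Lipschitz, and `K = N(1/2 − R)`; `N` cancels.
[cite: arXiv220412737, Lemma 4.1, (4.7)–(4.8)] -/
theorem oneLinkKRModulus_of_haarPoincare (hN : 1 ≤ N)
    (hLP : ∀ B : Matrix (Fin N) (Fin N) ℂ, matrixOpNorm B < 1 / 2 →
      ∀ (ψ : Matrix.specialUnitaryGroup (Fin N) ℂ → ℝ) (M : ℝ), 0 ≤ M →
        (∀ a b, |ψ a - ψ b| ≤ M * suFrobDist a b) →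
        Var[ψ; (haarProbability (Matrix.specialUnitaryGroup (Fin N) ℂ)).tilted
            fun g => (N : ℝ) * ((g : Matrix (Fin N) (Fin N) ℂ) * B).trace.re] ≤
          M ^ 2 / ((N : ℝ) * (1 / 2 - matrixOpNorm B)))
    {R : ℝ} (hR : R < 1 / 2) : OneLinkKRModulus N R (1 / (1 / 2 - R)) := by
  classical
  intro B B' hB hB' φ L hφm hφb hL hφL
  have hN0 : (0 : ℝ) < N := by exact_mod_cast (show 0 < N by omega)
  have hK0 : 0 < 1 / 2 - R := by linarith
  set K : ℝ := (N : ℝ) * (1 / 2 - R) with hK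
  have hKpos : 0 < K := mul_pos hN0 hK0
  set f : Matrix.specialUnitaryGroup (Fin N) ℂ → ℝ :=
    fun g => (N : ℝ) * ((g : Matrix (Fin N) (Fin N) ℂ) * B).trace.re with hf
  set w : Matrix.specialUnitaryGroup (Fin N) ℂ → ℝ :=
    fun g => (N : ℝ) * ((g : Matrix (Fin N) (Fin N) ℂ) * (B' - B)).trace.re with hw
  have hfw : (fun g : Matrix.specialUnitaryGroup (Fin N) ℂ =>
      (N : ℝ) * ((g : Matrix (Fin N) (Fin N) ℂ) * B').trace.re) = fun g => f g + w g := by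
    funext g
    simp only [hf, hw, Matrix.mul_sub, Matrix.trace_sub, Complex.sub_re]
    ring
  rw [hfw, abs_sub_comm]
  -- the Lipschitz constant of the perturbation `w`
  set D : ℝ := (N : ℝ) * frobNorm (B' - B) with hD
  have hD0 : 0 ≤ D := mul_nonneg hN0.le (frobNorm_nonneg _)
  have hwD : ∀ a b, |w a - w b| ≤ D * suFrobDist a b := fun a b => by
    simp only [hw]
    rw [← mul_sub, abs_mul, abs_of_nonneg hN0.le, hD, mul_assoc]
    refine mul_le_mul_of_nonneg_left ?_ hN0.le
    calc |((a : Matrix (Fin N) (Fin N) ℂ) * (B' - B)).trace.re -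
          ((b : Matrix (Fin N) (Fin N) ℂ) * (B' - B)).trace.re|
        ≤ suFrobDist a b * frobNorm (B' - B) := abs_re_trace_su_mul_sub_le a b _
      _ = frobNorm (B' - B) * suFrobDist a b := mul_comm _ _
  -- measurability and bounds
  have hfm : Measurable f := (continuous_const.mul (continuous_re_trace_su_mul B)).measurable
  have hwm : Measurable w := (continuous_const.mul (continuous_re_trace_su_mul (B' - B))).measurable
  have hfb : ∃ C, ∀ s, |f s| ≤ C := ⟨(N : ℝ) * (Real.sqrt N * frobNorm B), fun s => by
    simp only [hf]
    rw [abs_mul, abs_of_nonneg hN0.le]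
    exact mul_le_mul_of_nonneg_left (abs_re_trace_su_mul_le s B) hN0.le⟩
  have hwb : ∀ s, |w s| ≤ (N : ℝ) * (Real.sqrt N * frobNorm (B' - B)) := fun s => by
    simp only [hw]
    rw [abs_mul, abs_of_nonneg hN0.le]
    exact mul_le_mul_of_nonneg_left (abs_re_trace_su_mul_le s _) hN0.le
  -- the perturbation lemma along the interpolating tilts
  have key := abs_integral_tilted_add_sub_le (μ := haarProbability (Matrix.specialUnitaryGroup (Fin N) ℂ))
    (r := suFrobDist) hfm hfb hwm hwb hφm hφb hKpos hL hD0 hφL hwD ?_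
  · refine key.trans (le_of_eq ?_)
    rw [hD, hK, frobNorm_sub_comm]
    field_simp
  · -- the uniform Poincaré bound along the interpolation, supplied by `hLP`
    intro t ht ψ M hψm _hψb hM hψL
    set Bt : Matrix (Fin N) (Fin N) ℂ := B + (t : ℂ) • (B' - B) with hBt
    have hft : (fun u : Matrix.specialUnitaryGroup (Fin N) ℂ => f u + t * w u) =
        fun g : Matrix.specialUnitaryGroup (Fin N) ℂ =>
          (N : ℝ) * ((g : Matrix (Fin N) (Fin N) ℂ) * Bt).trace.re := by
      funext g
      simp only [hf, hw, hBt, Matrix.mul_add, Matrix.mul_smul, Matrix.trace_add,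
        Matrix.trace_smul, Complex.add_re, smul_eq_mul, Complex.re_ofReal_mul]
      ring
    have hBt_le : matrixOpNorm Bt ≤ R := by
      have h1 : Bt = ((1 - t : ℝ) : ℂ) • B + ((t : ℝ) : ℂ) • B' := by
        rw [hBt]
        push_cast
        simp only [smul_sub, sub_smul, one_smul]
        abel
      rw [h1]
      calc matrixOpNorm (((1 - t : ℝ) : ℂ) • B + ((t : ℝ) : ℂ) • B')
          ≤ matrixOpNorm (((1 - t : ℝ) : ℂ) • B) + matrixOpNorm (((t : ℝ) : ℂ) • B') :=
            matrixOpNorm_add_le _ _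
        _ = (1 - t) * matrixOpNorm B + t * matrixOpNorm B' := by
            rw [matrixOpNorm_smul, matrixOpNorm_smul, Complex.norm_real, Complex.norm_real,
              Real.norm_eq_abs, Real.norm_eq_abs, abs_of_nonneg (by linarith [ht.2]),
              abs_of_nonneg ht.1]
        _ ≤ (1 - t) * R + t * R :=
            add_le_add (mul_le_mul_of_nonneg_left hB (by linarith [ht.2]))
              (mul_le_mul_of_nonneg_left hB' ht.1)
        _ = R := by ring
    have hBt_lt : matrixOpNorm Bt < 1 / 2 := by linarith
    have hvar := hLP Bt hBt_lt ψ M hM hψL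
    rw [← hft, variance_eq_integral hψm.aemeasurable] at hvar
    refine hvar.trans ?_
    rw [hK]
    refine div_le_div_of_nonneg_left (sq_nonneg M) hKpos ?_
    exact mul_le_mul_of_nonneg_left (by linarith) hN0.le

/-- **Shen–Zhu–Zhu's window recovered through the kernel theorem.**  Under the one-link Poincaré hypothesis `hLP` the kernel
theorem with `R = 2(d−1)|β|`, `K = 1/(1/2 − R)` gives `DLRMassGapAt d N β` for every `|β| < 1/(16(d−1))` — the Dobrushin constant
is `6(d−1)|β|/(1/2 − 2(d−1)|β|) < 1 ⟺ 16(d−1)|β| < 1`, Assumption 1.1 on the nose.  So `dlrMassGap_of_oneLinkKRModulus` is the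
tree's S16 pipeline `shen_zhu_zhu_of_haarPoincare` with the one-link constant exposed; nothing new is claimed about the window here.
[cite: arXiv220412737, Assumption 1.1, Thm. 1.2 (Uniqueness and ergodicity), Lemma 4.1, Cor. 1.6 (Mass gap)] -/
theorem dlrMassGapAt_of_haarPoincare (hd : 2 ≤ d) (hN : 2 ≤ N)
    (hLP : ∀ B : Matrix (Fin N) (Fin N) ℂ, matrixOpNorm B < 1 / 2 →
      ∀ (ψ : Matrix.specialUnitaryGroup (Fin N) ℂ → ℝ) (M : ℝ), 0 ≤ M →
        (∀ a b, |ψ a - ψ b| ≤ M * suFrobDist a b) →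
        Var[ψ; (haarProbability (Matrix.specialUnitaryGroup (Fin N) ℂ)).tilted
            fun g => (N : ℝ) * ((g : Matrix (Fin N) (Fin N) ℂ) * B).trace.re] ≤
          M ^ 2 / ((N : ℝ) * (1 / 2 - matrixOpNorm B)))
    {β : ℝ} (hβ : |β| < 1 / (16 * ((d : ℝ) - 1))) : DLRMassGapAt d N β := by
  have hd2 : (2 : ℝ) ≤ d := by exact_mod_cast hd
  have hd0 : (0 : ℝ) < (d : ℝ) - 1 := by linarith
  set R : ℝ := |β| * (2 * ((d : ℝ) - 1)) with hR
  have hβ' : |β| * (16 * ((d : ℝ) - 1)) < 1 := by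
    rwa [lt_div_iff₀ (by positivity)] at hβ
  have hR8 : 8 * R < 1 := by rw [hR]; linarith
  have hR0 : 0 ≤ R := by positivity
  have hRlt : R < 1 / 2 := by linarith
  have hK0 : 0 < 1 / 2 - R := by linarith
  have hmod := oneLinkKRModulus_of_haarPoincare (by omega) hLP hRlt
  refine dlrMassGapAt_of_oneLinkKRModulus hd hN (K := 1 / (1 / 2 - R)) (by positivity) le_rfl hmod ?_
  -- `6(d-1)|β| / (1/2 - R) < 1 ⟺ 6(d-1)|β| < 1/2 - 2(d-1)|β| ⟺ 16(d-1)|β| < 1`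
  rw [mul_one_div, div_lt_one hK0, hR]
  nlinarith [abs_nonneg β]

end Literature.MathematicalPhysics.QuantumFieldTheory.Balaban1983to89.StrongCouplingDobrushinWindow
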